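import Mathlib
import HarnessLib

/-!
# Dependent random choice: the basic lemma (Fox–Sudakov, Lemma 2.1)

Source: J. Fox, B. Sudakov, *Dependent random choice*, Random Structures & Algorithms 38 (2011) 68–99
= arXiv:0909.3271 [FoxSudakov2011], §2 "Basic Lemma", Lemma 2.1 (attributed there to Kostochka–Rödl,
Sudakov, Alon–Krivelevich–Sudakov):

> **Lemma 2.1.** Let `a, d, m, n, r` be positive integers. Let `G = (V, E)` be a graph with `|V| = n` vertices and
> average degree `d = 2|E(G)|/n`. If there is a positive integer `t` such that `dᵗ/nᵗ⁻¹ − C(n, r) (m/n)ᵗ ≥ a`, then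
> `G` contains a subset `U` of at least `a` vertices such that every `r` vertices in `U` have at least `m` common
> neighbors.

We prove the printed statement (`FoxSudakov2011_lemma21`) from a TWO-SORTED (bipartite) form
(`dependentRandomChoice`: a relation `R` between finite sets `A` and `B`, tuples drawn from `B`, the rich set
found inside `A`, common neighbourhoods taken in `B`), which is the form used for bipartite / incidence /
orthogonality graphs; the hypothesis there is the pre-Jensen quantity
`(Σ_{v ∈ A} |N(v)|ᵗ)/|B|ᵗ − C(|A|, r) (m/|B|)ᵗ ≥ a`, and `sum_pow_card_filter_ge` supplies the convexity step
`Σ_v |N(v)|ᵗ ≥ |A| (e(A,B)/(|A||B|))ᵗ |B|ᵗ` of the printed proof. The proof is the printed one with the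
expectation over a uniformly random `t`-tuple `T ∈ Bᵗ` written as an average over all `|B|ᵗ` tuples (double
counting: `sum_card_tupleNbrs`, `sum_card_badIn`), the choice of a good tuple by averaging
(`Finset.exists_le_of_sum_le`), and the deletion of one vertex from each bad `r`-subset
(`exists_subset_avoiding`). Everything is proved; no named fact is introduced.

Why here (declared consumer): cell pnp-psdrank (summit PneNP, route `ChebyshevTracialDesign`), prover MEMO-14
§5 (b): «the natural tool is dependent random choice on the orthogonality graph». WHAT THIS IS NOT: none of the
survey's applications (§§3–10), no weighted variant, nothing problem-specific.
-/

namespace Literature.Combinatorics.Extremal.DependentRandomChoice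

open Finset

section TwoSorted

variable {α β : Type*}

/-- **Common neighbourhood** in `B` of a set `Y` under the relation `R`: `N(Y) = {b ∈ B : ∀ v ∈ Y, R v b}`.
[cite: FoxSudakov2011, §2 (the common neighborhood `N(U)`)] -/
def commonNbrs (B : Finset β) (R : α → β → Prop) [∀ a b, Decidable (R a b)] (Y : Finset α) : Finset β :=
  B.filter fun b => ∀ v ∈ Y, R v b

/-- Membership in the common neighbourhood. [cite: FoxSudakov2011, §2] -/
@[simp] theorem mem_commonNbrs {B : Finset β} {R : α → β → Prop} [∀ a b, Decidable (R a b)] {Y : Finset α} {b : β} :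
    b ∈ commonNbrs B R Y ↔ b ∈ B ∧ ∀ v ∈ Y, R v b := mem_filter

/-- The common neighbourhood of a single vertex is its neighbourhood. [cite: FoxSudakov2011, §2] -/
theorem commonNbrs_singleton (B : Finset β) (R : α → β → Prop) [∀ a b, Decidable (R a b)] (v : α) :
    commonNbrs B R {v} = B.filter (R v) := by
  ext b
  simp only [mem_commonNbrs, mem_singleton, forall_eq, mem_filter]

/-- **The dependent set** `N(T) ∩ A` of a tuple `T ∈ Bᵗ`: the members of `A` related to every coordinate of `T`.
[cite: FoxSudakov2011, Lemma 2.1 (proof: `A = N(T)`)] -/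
def tupleNbrs (A : Finset α) (R : α → β → Prop) [∀ a b, Decidable (R a b)] {t : ℕ} (T : Fin t → β) : Finset α :=
  A.filter fun v => ∀ i, R v (T i)

/-- Membership in the dependent set. [cite: FoxSudakov2011, Lemma 2.1 (proof)] -/
@[simp] theorem mem_tupleNbrs {A : Finset α} {R : α → β → Prop} [∀ a b, Decidable (R a b)] {t : ℕ} {T : Fin t → β}
    {v : α} : v ∈ tupleNbrs A R T ↔ v ∈ A ∧ ∀ i, R v (T i) := mem_filter

/-- The dependent set lies inside `A`. [cite: FoxSudakov2011, Lemma 2.1 (proof)] -/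
theorem tupleNbrs_subset (A : Finset α) (R : α → β → Prop) [∀ a b, Decidable (R a b)] {t : ℕ} (T : Fin t → β) :
    tupleNbrs A R T ⊆ A := filter_subset _ _

/-- Tuples all of whose coordinates satisfy `p` are the tuples over the filtered set. [folklore] -/
private theorem filter_piFinset_forall [DecidableEq β] (t : ℕ) (B : Finset β) (p : β → Prop) [DecidablePred p] :
    (Fintype.piFinset fun _ : Fin t => B).filter (fun T => ∀ i, p (T i)) = Fintype.piFinset fun _ : Fin t => B.filter p := by
  ext T
  simp only [mem_filter, Fintype.mem_piFinset]
  exact ⟨fun h i => ⟨h.1 i, h.2 i⟩, fun h => ⟨fun i => (h i).1, fun i => (h i).2⟩⟩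

/-- **`𝔼|N(T) ∩ A|`, as a sum over all tuples**: `Σ_{T ∈ Bᵗ} |N(T) ∩ A| = Σ_{v ∈ A} |N(v)|ᵗ`
(linearity of expectation: `v` lies in `N(T)` for exactly `|N(v)|ᵗ` tuples). [cite: FoxSudakov2011, Lemma 2.1 (proof, the display for `𝔼[X]`)] -/
theorem sum_card_tupleNbrs [DecidableEq β] (A : Finset α) (B : Finset β) (R : α → β → Prop) [∀ a b, Decidable (R a b)] (t : ℕ) :
    ∑ T ∈ Fintype.piFinset (fun _ : Fin t => B), (tupleNbrs A R T).card = ∑ v ∈ A, (B.filter (R v)).card ^ t := by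
  calc ∑ T ∈ Fintype.piFinset (fun _ : Fin t => B), (tupleNbrs A R T).card
      = ∑ T ∈ Fintype.piFinset (fun _ : Fin t => B), ∑ v ∈ A, (if (∀ i, R v (T i)) then 1 else 0) :=
        sum_congr rfl fun T _ => card_filter _ _
    _ = ∑ v ∈ A, ∑ T ∈ Fintype.piFinset (fun _ : Fin t => B), (if (∀ i, R v (T i)) then 1 else 0) := sum_comm
    _ = ∑ v ∈ A, (B.filter (R v)).card ^ t := by
        refine sum_congr rfl fun v _ => ?_
        rw [sum_boole, Nat.cast_id, filter_piFinset_forall t B (R v), Fintype.card_piFinset_const]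

/-- **The bad `r`-subsets**: the `r`-subsets of `A` with fewer than `m` common neighbours in `B`.
[cite: FoxSudakov2011, Lemma 2.1 (proof: "subsets `S ⊂ A` of size `r` with fewer than `m` common neighbors")] -/
def badSets (A : Finset α) (B : Finset β) (R : α → β → Prop) [∀ a b, Decidable (R a b)] (r m : ℕ) : Finset (Finset α) :=
  (A.powersetCard r).filter fun Y => (commonNbrs B R Y).card < m

/-- Membership in `badSets`. [cite: FoxSudakov2011, Lemma 2.1 (proof)] -/
theorem mem_badSets {A : Finset α} {B : Finset β} {R : α → β → Prop} [∀ a b, Decidable (R a b)] {r m : ℕ}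
    {Y : Finset α} : Y ∈ badSets A B R r m ↔ Y ⊆ A ∧ Y.card = r ∧ (commonNbrs B R Y).card < m := by
  simp only [badSets, mem_filter, mem_powersetCard, and_assoc]

/-- There are at most `C(|A|, r)` bad `r`-subsets. [cite: FoxSudakov2011, Lemma 2.1 (proof: "at most `C(n, r)` subsets")] -/
theorem card_badSets_le (A : Finset α) (B : Finset β) (R : α → β → Prop) [∀ a b, Decidable (R a b)] (r m : ℕ) :
    (badSets A B R r m).card ≤ A.card.choose r :=
  (card_filter_le _ _).trans (card_powersetCard _ _).le

/-- A subset of the dependent set of `T` is a subset of `A` whose common neighbourhood contains every coordinate of `T`.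
[cite: FoxSudakov2011, Lemma 2.1 (proof: "the probability that `S` is a subset of `A` equals `(|N(S)|/n)ᵗ`")] -/
theorem subset_tupleNbrs_iff {A : Finset α} {B : Finset β} {R : α → β → Prop} [∀ a b, Decidable (R a b)] {t : ℕ}
    {T : Fin t → β} (hT : ∀ i, T i ∈ B) {Y : Finset α} :
    Y ⊆ tupleNbrs A R T ↔ Y ⊆ A ∧ ∀ i, T i ∈ commonNbrs B R Y := by
  simp only [subset_iff, mem_tupleNbrs, mem_commonNbrs]
  constructor
  · intro h
    exact ⟨fun v hv => (h hv).1, fun i => ⟨hT i, fun v hv => (h hv).2 i⟩⟩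
  · rintro ⟨hYA, hTi⟩ v hv
    exact ⟨hYA hv, fun i => (hTi i).2 v hv⟩

/-- **`𝔼[Y]`, as a sum over all tuples**: the number of pairs (tuple `T`, bad set inside `N(T) ∩ A`) is
`Σ_{Y bad} |N(Y)|ᵗ`. [cite: FoxSudakov2011, Lemma 2.1 (proof, the display for `𝔼[Y]`)] -/
theorem sum_card_badIn [DecidableEq α] [DecidableEq β] (A : Finset α) (B : Finset β) (R : α → β → Prop) [∀ a b, Decidable (R a b)] (t r m : ℕ) :
    ∑ T ∈ Fintype.piFinset (fun _ : Fin t => B), ((badSets A B R r m).filter fun Y => Y ⊆ tupleNbrs A R T).card =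
      ∑ Y ∈ badSets A B R r m, (commonNbrs B R Y).card ^ t := by
  calc ∑ T ∈ Fintype.piFinset (fun _ : Fin t => B), ((badSets A B R r m).filter fun Y => Y ⊆ tupleNbrs A R T).card
      = ∑ T ∈ Fintype.piFinset (fun _ : Fin t => B), ∑ Y ∈ badSets A B R r m,
          (if Y ⊆ tupleNbrs A R T then 1 else 0) := sum_congr rfl fun T _ => card_filter _ _
    _ = ∑ Y ∈ badSets A B R r m, ∑ T ∈ Fintype.piFinset (fun _ : Fin t => B),
          (if Y ⊆ tupleNbrs A R T then 1 else 0) := sum_comm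
    _ = ∑ Y ∈ badSets A B R r m, (commonNbrs B R Y).card ^ t := by
        refine sum_congr rfl fun Y hY => ?_
        have hYA : Y ⊆ A := (mem_badSets.1 hY).1
        rw [sum_boole, Nat.cast_id]
        have hfilter : (Fintype.piFinset (fun _ : Fin t => B)).filter (fun T => Y ⊆ tupleNbrs A R T) =
            Fintype.piFinset fun _ : Fin t => commonNbrs B R Y := by
          ext T
          simp only [mem_filter, Fintype.mem_piFinset]
          constructor
          · rintro ⟨hTB, hYT⟩
            exact ((subset_tupleNbrs_iff hTB).1 hYT).2
          · intro hTN
            have hTB : ∀ i, T i ∈ B := fun i => (mem_commonNbrs.1 (hTN i)).1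
            exact ⟨hTB, (subset_tupleNbrs_iff hTB).2 ⟨hYA, hTN⟩⟩
        rw [hfilter, Fintype.card_piFinset_const]

/-- Hence `Σ_T #{bad sets inside N(T) ∩ A} ≤ C(|A|, r) · mᵗ` (each bad set has `|N(Y)| < m`).
[cite: FoxSudakov2011, Lemma 2.1 (proof: `𝔼[Y] < C(n, r)(m/n)ᵗ`)] -/
theorem sum_card_badIn_le [DecidableEq α] [DecidableEq β] (A : Finset α) (B : Finset β) (R : α → β → Prop) [∀ a b, Decidable (R a b)] (t r m : ℕ) :
    ∑ T ∈ Fintype.piFinset (fun _ : Fin t => B), ((badSets A B R r m).filter fun Y => Y ⊆ tupleNbrs A R T).card ≤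
      A.card.choose r * m ^ t := by
  rw [sum_card_badIn]
  calc ∑ Y ∈ badSets A B R r m, (commonNbrs B R Y).card ^ t ≤ ∑ Y ∈ badSets A B R r m, m ^ t :=
        sum_le_sum fun Y hY => Nat.pow_le_pow_left (mem_badSets.1 hY).2.2.le t
    _ = (badSets A B R r m).card * m ^ t := by rw [sum_const, smul_eq_mul]
    _ ≤ A.card.choose r * m ^ t := Nat.mul_le_mul_right _ (card_badSets_le A B R r m)

/-- **Deleting one vertex from each bad set.** For a finite family `𝒴b` of NONEMPTY sets there is `U ⊆ S` with
`|S| ≤ |U| + |𝒴b|` containing no member of `𝒴b`. [cite: FoxSudakov2011, Lemma 2.1 (proof: "Delete one vertex from each subset `S` of `A` of size `r` with fewer than `m` common neighbors")] -/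
theorem exists_subset_avoiding [DecidableEq α] (S : Finset α) (𝒴b : Finset (Finset α)) (h𝒴b : ∀ Y ∈ 𝒴b, Y.Nonempty) :
    ∃ U ⊆ S, S.card ≤ U.card + 𝒴b.card ∧ ∀ Y ∈ 𝒴b, ¬Y ⊆ U := by
  classical
  induction 𝒴b using Finset.induction_on with
  | empty => exact ⟨S, Subset.rfl, by simp, fun Y hY => absurd hY (by simp)⟩
  | insert Y 𝒴b hY𝒴b ih =>
    obtain ⟨U', hU'S, hcard, havoid⟩ := ih fun Y' hY' => h𝒴b Y' (mem_insert_of_mem hY')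
    obtain ⟨y, hy⟩ := h𝒴b Y (mem_insert_self Y 𝒴b)
    refine ⟨U'.erase y, (erase_subset y U').trans hU'S, ?_, fun Y' hY' hsub => ?_⟩
    · rw [card_insert_of_notMem hY𝒴b]
      have := pred_card_le_card_erase (s := U') (a := y)
      omega
    · rcases mem_insert.1 hY' with rfl | hY'
      · exact notMem_erase y U' (hsub hy)
      · exact havoid Y' hY' (hsub.trans (erase_subset y U'))

/-- **DEPENDENT RANDOM CHOICE, two-sorted form.** Let `R` be a relation between finite sets `A` and `B`, `r ≥ 1`,
and `t, m` naturals. If `(Σ_{v ∈ A} |N(v)|ᵗ)/|B|ᵗ − C(|A|, r)·(m/|B|)ᵗ ≥ a` (`N(v) = {b ∈ B : R v b}`), then there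
is `U ⊆ A` with `|U| ≥ a` such that every `r`-subset of `U` has at least `m` common neighbours in `B`. (Printed
proof: average over all `|B|ᵗ` tuples `T ∈ Bᵗ` of `|N(T) ∩ A| − #{bad r-subsets inside}`, pick a tuple at least as
good as the average, delete one vertex from each bad set.) [cite: FoxSudakov2011, Lemma 2.1] -/
theorem dependentRandomChoice [DecidableEq α] [DecidableEq β] (A : Finset α) (B : Finset β) (R : α → β → Prop) [∀ a b, Decidable (R a b)]
    (t : ℕ) {r : ℕ} (hr : 1 ≤ r) (m : ℕ) {a : ℝ}
    (h : a ≤ (∑ v ∈ A, ((B.filter (R v)).card : ℝ) ^ t) / (B.card : ℝ) ^ t -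
      (A.card.choose r : ℝ) * ((m : ℝ) / B.card) ^ t) :
    ∃ U ⊆ A, a ≤ U.card ∧ ∀ Y ⊆ U, Y.card = r → m ≤ (commonNbrs B R Y).card := by
  set 𝒯 : Finset (Fin t → β) := Fintype.piFinset fun _ : Fin t => B with h𝒯def
  -- the good-tuple functional `X_T − Y_T`
  set Φ : (Fin t → β) → ℝ := fun T =>
    ((tupleNbrs A R T).card : ℝ) - (((badSets A B R r m).filter fun Y => Y ⊆ tupleNbrs A R T).card : ℝ) with hΦdef
  -- from a good tuple, delete one vertex from each bad set inside its dependent set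
  have finish : ∀ T : Fin t → β, a ≤ Φ T →
      ∃ U ⊆ A, a ≤ U.card ∧ ∀ Y ⊆ U, Y.card = r → m ≤ (commonNbrs B R Y).card := by
    intro T hT
    set S := tupleNbrs A R T with hSdef
    set 𝒴b := (badSets A B R r m).filter fun Y => Y ⊆ S with h𝒴bdef
    have hne : ∀ Y ∈ 𝒴b, Y.Nonempty := fun Y hY => by
      rw [← card_pos, (mem_badSets.1 (mem_filter.1 hY).1).2.1]; exact hr
    obtain ⟨U, hUS, hcard, havoid⟩ := exists_subset_avoiding S 𝒴b hne
    refine ⟨U, hUS.trans (tupleNbrs_subset A R T), hT.trans ?_, fun Y hYU hYr => ?_⟩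
    · have : (S.card : ℝ) ≤ U.card + 𝒴b.card := by exact_mod_cast hcard
      simp only [hΦdef]
      linarith
    · by_contra hlt
      exact havoid Y (mem_filter.2 ⟨mem_badSets.2 ⟨(hYU.trans hUS).trans (tupleNbrs_subset A R T), hYr, not_le.1 hlt⟩,
        hYU.trans hUS⟩) hYU
  rcases 𝒯.eq_empty_or_nonempty with h𝒯0 | h𝒯ne
  · -- no tuples: `B = ∅` and `t ≥ 1`, so the hypothesis reads `a ≤ 0`; any tuple-free witness will do — use `U = ∅`
    have hB : B = ∅ ∧ t ≠ 0 := by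
      have := Fintype.piFinset_eq_empty.1 h𝒯0
      obtain ⟨_, hB⟩ := this
      refine ⟨hB, ?_⟩
      rintro rfl
      exact (Fintype.piFinset_nonempty.2 fun i => i.elim0).ne_empty h𝒯0
    have ha : a ≤ 0 := by
      have h1 : ((B.card : ℝ)) ^ t = 0 := by rw [hB.1, card_empty, Nat.cast_zero, zero_pow hB.2]
      rw [h1, div_zero, hB.1, card_empty, Nat.cast_zero, div_zero, zero_pow hB.2, mul_zero, sub_zero] at h
      exact h
    refine ⟨∅, empty_subset _, by simpa using ha, fun Y hY hYr => ?_⟩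
    have : Y = ∅ := subset_empty.1 hY
    rw [this, card_empty] at hYr
    omega
  -- averaging: `Σ_T Φ(T) ≥ Σ_v |N(v)|ᵗ − C(|A|, r) mᵗ = |B|ᵗ · (hypothesis RHS) ≥ |B|ᵗ · a`
  have hBpos : (0 : ℝ) < (B.card : ℝ) ^ t := by
    rcases Nat.eq_zero_or_pos t with rfl | ht
    · simp
    · have hB : B.Nonempty := (Fintype.piFinset_nonempty.1 h𝒯ne) ⟨0, ht⟩
      exact pow_pos (by exact_mod_cast hB.card_pos) t
  have hcard𝒯 : (𝒯.card : ℝ) = (B.card : ℝ) ^ t := by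
    rw [h𝒯def, Fintype.card_piFinset_const]; push_cast; ring
  have hsum : ∑ T ∈ 𝒯, Φ T ≥ (B.card : ℝ) ^ t * a := by
    have hX : ∑ T ∈ 𝒯, ((tupleNbrs A R T).card : ℝ) = ∑ v ∈ A, ((B.filter (R v)).card : ℝ) ^ t := by
      exact_mod_cast sum_card_tupleNbrs A B R t
    have hY : ∑ T ∈ 𝒯, (((badSets A B R r m).filter fun Y => Y ⊆ tupleNbrs A R T).card : ℝ) ≤
        (A.card.choose r : ℝ) * (m : ℝ) ^ t := by
      exact_mod_cast sum_card_badIn_le A B R t r m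
    have hrhs : (B.card : ℝ) ^ t * a ≤ ∑ v ∈ A, ((B.filter (R v)).card : ℝ) ^ t - (A.card.choose r : ℝ) * (m : ℝ) ^ t := by
      have e1 : (∑ v ∈ A, ((B.filter (R v)).card : ℝ) ^ t) / (B.card : ℝ) ^ t * (B.card : ℝ) ^ t =
          ∑ v ∈ A, ((B.filter (R v)).card : ℝ) ^ t := div_mul_cancel₀ _ hBpos.ne'
      have e2 : ((m : ℝ) / B.card) ^ t * (B.card : ℝ) ^ t = (m : ℝ) ^ t := by
        rw [div_pow, div_mul_cancel₀ _ hBpos.ne']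
      have := mul_le_mul_of_nonneg_right h hBpos.le
      rw [sub_mul, e1, mul_assoc, e2] at this
      linarith
    simp only [hΦdef, sum_sub_distrib, hX]
    linarith
  -- a tuple at least as good as the average
  obtain ⟨T, -, hT⟩ := exists_le_of_sum_le h𝒯ne (f := fun _ => a) (g := Φ) (by
    rw [sum_const, nsmul_eq_mul, hcard𝒯]; exact hsum)
  exact finish T hT

/-- **The convexity step** of the printed proof: `Σ_{v ∈ A} |N(v)|ᵗ ≥ |A|·(e/|A|)ᵗ`, `e = Σ_v |N(v)|` the number of
related pairs (Jensen for `z ↦ zᵗ`). [cite: FoxSudakov2011, Lemma 2.1 (proof: "the last inequality is by convexity of the function `f(z) = zᵗ`")] -/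
theorem card_mul_pow_avg_le_sum_pow (A : Finset α) (B : Finset β) (R : α → β → Prop) [∀ a b, Decidable (R a b)]
    {t : ℕ} (ht : 1 ≤ t) (hA : A.Nonempty) :
    (A.card : ℝ) * ((∑ v ∈ A, ((B.filter (R v)).card : ℝ)) / A.card) ^ t ≤
      ∑ v ∈ A, ((B.filter (R v)).card : ℝ) ^ t := by
  have hApos : (0 : ℝ) < A.card := by exact_mod_cast hA.card_pos
  obtain ⟨s, rfl⟩ : ∃ s, t = s + 1 := ⟨t - 1, by omega⟩
  have key := pow_sum_le_card_mul_sum_pow (s := A) (f := fun v => ((B.filter (R v)).card : ℝ))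
    (fun v _ => Nat.cast_nonneg _) s
  rw [div_pow, pow_succ (A.card : ℝ) s]
  rw [show (A.card : ℝ) * ((∑ v ∈ A, ((B.filter (R v)).card : ℝ)) ^ (s + 1) / ((A.card : ℝ) ^ s * A.card)) =
      (∑ v ∈ A, ((B.filter (R v)).card : ℝ)) ^ (s + 1) / (A.card : ℝ) ^ s by
    field_simp]
  rw [div_le_iff₀ (pow_pos hApos s)]
  linarith [key]

/-- **DEPENDENT RANDOM CHOICE, two-sorted form with the printed (post-Jensen) hypothesis**: if `R` relates `e` pairs of
`A × B` and `|A| (e/(|A||B|))ᵗ − C(|A|, r)(m/|B|)ᵗ ≥ a` for some `t ≥ 1` (`r ≥ 1`), then some `U ⊆ A` with `|U| ≥ a` has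
every `r`-subset with at least `m` common neighbours in `B`. [cite: FoxSudakov2011, Lemma 2.1] -/
theorem dependentRandomChoice_density [DecidableEq α] [DecidableEq β] (A : Finset α) (B : Finset β) (R : α → β → Prop) [∀ a b, Decidable (R a b)]
    {t : ℕ} (ht : 1 ≤ t) {r : ℕ} (hr : 1 ≤ r) (m : ℕ) {a : ℝ}
    (h : a ≤ (A.card : ℝ) * ((∑ v ∈ A, ((B.filter (R v)).card : ℝ)) / (A.card * B.card)) ^ t -
      (A.card.choose r : ℝ) * ((m : ℝ) / B.card) ^ t) :
    ∃ U ⊆ A, a ≤ U.card ∧ ∀ Y ⊆ U, Y.card = r → m ≤ (commonNbrs B R Y).card := by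
  refine dependentRandomChoice A B R t hr m (h.trans (sub_le_sub_right ?_ _))
  rcases A.eq_empty_or_nonempty with rfl | hA
  · simp
  have hApos : (0 : ℝ) < A.card := by exact_mod_cast hA.card_pos
  rcases Nat.eq_zero_or_pos B.card with hB0 | hBpos
  · -- `B = ∅`: both sides vanish (`t ≥ 1`)
    have ht0 : t ≠ 0 := by omega
    have hB : B = ∅ := card_eq_zero.1 hB0
    subst hB
    simp [zero_pow ht0]
  have hBpos' : (0 : ℝ) < (B.card : ℝ) ^ t := pow_pos (by exact_mod_cast hBpos) t
  rw [le_div_iff₀ hBpos', show (A.card : ℝ) * ((∑ v ∈ A, ((B.filter (R v)).card : ℝ)) / (A.card * B.card)) ^ t *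
      (B.card : ℝ) ^ t = (A.card : ℝ) * ((∑ v ∈ A, ((B.filter (R v)).card : ℝ)) / A.card) ^ t by
    rw [div_pow, div_pow, mul_pow]
    field_simp]
  exact card_mul_pow_avg_le_sum_pow A B R ht hA

end TwoSorted

/-! ## The printed graph form -/

section Graph

variable {V : Type*} [Fintype V] [DecidableEq V] (G : SimpleGraph V) [DecidableRel G.Adj]

/-- **Fox–Sudakov Lemma 2.1 (dependent random choice), as printed.** Let `G` be a graph on `n` vertices with average
degree `d = 2|E(G)|/n`, and `a, m, r, t` positive integers with `dᵗ/nᵗ⁻¹ − C(n, r)(m/n)ᵗ ≥ a`. Then `G` contains a set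
`U` of at least `a` vertices such that every `r` vertices of `U` have at least `m` common neighbours
(`commonNbrs univ G.Adj S = {w : ∀ v ∈ S, G.Adj v w}`). [cite: FoxSudakov2011, Lemma 2.1] -/
theorem FoxSudakov2011_lemma21 {a m r t : ℕ} (hr : 1 ≤ r) (ht : 1 ≤ t)
    (h : (a : ℝ) ≤ ((2 * G.edgeFinset.card : ℝ) / Fintype.card V) ^ t / (Fintype.card V : ℝ) ^ (t - 1) -
      ((Fintype.card V).choose r : ℝ) * ((m : ℝ) / Fintype.card V) ^ t) :
    ∃ U : Finset V, a ≤ U.card ∧ ∀ S ⊆ U, S.card = r → m ≤ (commonNbrs univ G.Adj S).card := by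
  have hdeg : ∑ v ∈ (univ : Finset V), (((univ : Finset V).filter (G.Adj v)).card : ℝ) = 2 * G.edgeFinset.card := by
    have h1 : ∀ v : V, ((univ : Finset V).filter (G.Adj v)).card = G.degree v := fun v => by
      rw [← SimpleGraph.card_neighborFinset_eq_degree, SimpleGraph.neighborFinset_eq_filter]
    simp only [h1]
    exact_mod_cast G.sum_degrees_eq_twice_card_edges
  obtain ⟨U, -, hU, hrich⟩ := dependentRandomChoice_density (univ : Finset V) (univ : Finset V) G.Adj ht hr m
    (a := (a : ℝ)) (by
      rw [card_univ, hdeg]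
      refine h.trans (sub_le_sub_right (le_of_eq ?_) _)
      rcases Nat.eq_zero_or_pos (Fintype.card V) with hn | hn
      · have ht0 : t ≠ 0 := by omega
        simp [hn, zero_pow ht0]
      · have hnpos : (0 : ℝ) < Fintype.card V := by exact_mod_cast hn
        obtain ⟨s, rfl⟩ : ∃ s, t = s + 1 := ⟨t - 1, by omega⟩
        rw [Nat.add_sub_cancel, div_pow, div_pow, mul_pow, pow_succ (Fintype.card V : ℝ) s]
        field_simp
        ring)
  exact ⟨U, by exact_mod_cast hU, hrich⟩

end Graph

end Literature.Combinatorics.Extremal.DependentRandomChoice
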